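import Summits.KontsevichZagierPeriods.KontsevichZagierPeriods.Theorems.LinRedNormalFormArrangementNormalFormSeparateThreeHHKSecIIIPrep
import Summits.KontsevichZagierPeriods.KontsevichZagierPeriods.Theorems.LinRedNormalFormArrangementNormalFormSeparateThreeHHKSecAway

/-!
# The sector theorem of type (III), monomial frames: trigraded

(Line `janus-bands`, crux `ArrangementNormalForm`, stub `stub_separateHigh`, part `HHKSecIIIb` of
the wall-invariant termwise-split lemma `separateThree_hHk` in base dimension `3` with fibres.)
At a base point `z₁` of the pole plane and a direction `d` in the pole plane, consider the nested
sector with a MONOMIAL frame — the vertical frame `Q = Qy E`, `S = Sc c` or the slope-`0` frame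
`Q = Qc c`, `S = Sy E` (part `HHKSecIIIPrep`). Along it every Taylor piece is an honest
polynomial `pev₃ (g i)` in `(t, v, u)` and distinct pieces have DISJOINT monomial supports
(part `HHKFormsB`), so the plain three-variable monomial splitting `SepHHK.ray_trigraded3` bounds
every piece by the total: the density `𝟙_Y (∑ |Ri i|) m` has finite integral over the sector for
all small scales (`sector_IIImono` for an abstract disjoint tensor family, registered as
`separateThreeHHK_secIIIb`; `sector_IIIvert`, `sector_IIIzero`).
-/

noncomputable section

open Set MeasureTheory Filter Topology
open scoped ENNReal

namespace Summit.KontsevichZagierPeriods.ArrangementNormalForm.JanusBands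

namespace SepHHK

open SepTwo

/-- **The sector theorem of type (III) for a frame with disjoint piece tensors.** -/
theorem sector_IIImono {k mL m'' : ℕ} (φ : Fin m'' → (Fin 3 → ℝ) × ℝ)
    (lo hi : Fin k → Fin k ⊕ Atm 3) (a : Fin k → Option (Atm 3))
    (κ : Fin mL → Fin 2 → ℝ) (μ : Fin mL → ℝ) (e : Fin mL → ℕ) (n : ℕ) (l₁ l₂ l₀ : ℝ)
    (N : ℕ) (q : ℕ → MvPolynomial (Fin 2) ℝ) (R : (Fin 3 → ℝ) → ℝ) (Ri : ℕ → (Fin 3 → ℝ) → ℝ)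
    (z₁ : Fin 3 → ℝ)
    (hR : ∀ x, R x = (∑ i ∈ Finset.range N, MvPolynomial.eval (pr2 x) (q i) * lam3 l₁ l₂ l₀ x ^ i) /
      common κ μ e n l₁ l₂ l₀ x)
    (hRi : ∀ i < N, ∀ x, Ri i x = MvPolynomial.eval (pr2 x) (q i) * lam3 l₁ l₂ l₀ x ^ i /
      common κ μ e n l₁ l₂ l₀ x)
    (hRm : Measurable R) (hRim : ∀ i, Measurable (Ri i))
    (hfinY : ∫⁻ x in {x | ∀ j, 0 < rav x (φ j)}, ENNReal.ofReal |R x| * lmass lo hi a (av x) < ∞)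
    (hlam : lam3 l₁ l₂ l₀ z₁ = 0) (d : Fin 3 → ℝ) (hd : lamL l₁ l₂ d = 0) (cw : Fin 2 → ℝ)
    (hdc : d 0 * cw 1 - d 1 * cw 0 ≠ 0)
    {D : ℕ} (hND : N ≤ D + 1) (β : Coef₃ D)
    (hβ : ∀ (i : ℕ) (hi : i < N) (w₁ w₂ : ℝ), MvPolynomial.eval (pr2 z₁ + w₁ • pr2 d + w₂ • cw) (q i) =
      pev₂ (β ⟨i, lt_of_lt_of_le hi hND⟩) w₁ w₂)
    (hβ0 : ∀ i : Fin (D + 1), N ≤ (i : ℕ) → β i = 0)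
    (Qy Qc Sy Sc : ℝ) (hfr : Qy * Sc - Qc * Sy ≠ 0)
    (hκ : ∀ j ∈ thr κ μ e z₁, klin κ j d ≠ 0 ∨ κ j 0 * cw 0 + κ j 1 * cw 1 ≠ 0)
    (g : Fin (D + 1) → Coef₃ (3 * D))
    (hg : ∀ (i : Fin (D + 1)) (t v u : ℝ), pev₃ (g i) t v u = G3p β Qy Sy Qc Sc i t v u)
    (hdisj : ∀ a' b' c' i i', g i a' b' c' ≠ 0 → g i' a' b' c' ≠ 0 → i = i') :
    ∀ᶠ δt in 𝓝[>] (0 : ℝ), ∀ᶠ δ in 𝓝[>] (0 : ℝ), ∀ᶠ ε in 𝓝[>] (0 : ℝ),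
      ∫⁻ z in nsector z₁ d (frameIII l₁ l₂ cw Qy Qc) (frameIII l₁ l₂ cw Sy Sc) δt δ (Ico 0 ε),
        {x : Fin 3 → ℝ | ∀ j, 0 < rav x (φ j)}.indicator
        (fun x => (∑ i ∈ Finset.range N, ENNReal.ofReal |Ri i x|) * lmass lo hi a (av x)) z < ∞ := by
  set Y : Set (Fin 3 → ℝ) := {x | ∀ j, 0 < rav x (φ j)} with hY
  have hYm : MeasurableSet Y := measurableSet_Y3 φ
  set mm : (Fin 3 → ℝ) → ℝ≥0∞ := fun x => lmass lo hi a (av x) with hmm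
  have hm : Measurable mm := measurable_lmass_av lo hi a
  set Q : Fin 3 → ℝ := frameIII l₁ l₂ cw Qy Qc with hQ
  set S : Fin 3 → ℝ := frameIII l₁ l₂ cw Sy Sc with hS
  have hdet : det3 d Q S ≠ 0 := by
    rw [det3_frameIII l₁ l₂ d hd]
    exact mul_ne_zero (by intro h; apply hfr; linarith) hdc
  have hLQ : lamL l₁ l₂ Q = Qy := lamL_frameIII l₁ l₂ cw Qy Qc
  have hLS : lamL l₁ l₂ S = Sy := lamL_frameIII l₁ l₂ cw Sy Sc
  have hQS : Qy ≠ 0 ∨ Sy ≠ 0 := by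
    by_contra h
    push Not at h
    apply hfr; rw [h.1, h.2]; ring
  have hQS' : Qc ≠ 0 ∨ Sc ≠ 0 := by
    by_contra h
    push Not at h
    apply hfr; rw [h.1, h.2]; ring
  have hκ' : ∀ j ∈ thr κ μ e z₁, klin κ j d ≠ 0 ∨ klin κ j Q ≠ 0 ∨ klin κ j S ≠ 0 := by
    intro j hj
    rcases hκ j hj with h | h
    · exact Or.inl h
    · rcases hQS' with h' | h'
      · exact Or.inr (Or.inl (by rw [klin_frameIII]; exact mul_ne_zero h' h))
      · exact Or.inr (Or.inr (by rw [klin_frameIII]; exact mul_ne_zero h' h))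
  -- the regular factor
  set ω : ℝ → ℝ → ℝ → ℝ := omega3 κ μ e n l₁ l₂ z₁ d Q S with hω
  have hωc : Continuous fun p : ℝ × ℝ × ℝ => ω p.1 p.2.1 p.2.2 := continuous_omega3 κ μ e n l₁ l₂ z₁ d Q S
  have hωm : Measurable fun p : ℝ × ℝ × ℝ => ω p.1 p.2.1 p.2.2 := hωc.measurable
  have hω0 : (fun p : ℝ × ℝ × ℝ => ω p.1 p.2.1 p.2.2) 0 ≠ 0 := by
    simp only [hω, Prod.fst_zero, Prod.snd_zero]
    refine omega3_corner_ne_zero κ μ e n l₁ l₂ z₁ d Q S (Or.inr (Or.inr ?_)) hκ'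
    rcases hQS with h | h
    · exact Or.inl (by rw [hLQ]; exact h)
    · exact Or.inr (by rw [hLS]; exact h)
  obtain ⟨ωlo, hωlo, ωhi, ρ, hρ, hωb⟩ := exists_corner_bounds _ hωc hω0
  set Dt : ℕ := Dt3 κ μ e n z₁ with hDt
  set Dv : ℕ := Dv3 κ μ e n l₁ l₂ z₁ d with hDv
  set Du : ℕ := Du3 κ μ e n l₁ l₂ z₁ d Q with hDu
  have hcommon : ∀ t v u : ℝ, 0 ≤ t → 0 ≤ v → 0 ≤ u →
      |common κ μ e n l₁ l₂ l₀ (npt z₁ d Q S t v u)| = t ^ Dt * v ^ Dv * u ^ Du * |ω t v u| :=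
    fun t v u ht hv hu => abs_common_npt κ μ e n l₁ l₂ l₀ z₁ d Q S hlam ht hv hu
  -- weight data
  obtain ⟨δ₀, hδ₀, ε₀, hε₀, η₀, hη₀, KΛ, hKΛ, -, -, -, hΛmono, -⟩ := weight_hyps3 lo hi a z₁ d Q S
  -- sign dichotomy and scales
  have hsign := eventually_in_or_out3 φ z₁ d Q S
  have hcδt : 0 < min (δ₀ / 4) (ρ / 4) := by positivity
  filter_upwards [hsign, Ioo_mem_nhdsGT hcδt] with δt hsδt hδt
  have hδtpos : 0 < δt := hδt.1
  obtain ⟨hδt0, hδtρ⟩ := lt_min_iff.1 hδt.2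
  have h4δt : 4 * δt ≤ δ₀ := by linarith
  have hcδ : 0 < min (ε₀ / 4) (ρ / 4) := by positivity
  filter_upwards [hsδt, Ioo_mem_nhdsGT hcδ] with δ hsδ hδ
  have hδpos : 0 < δ := hδ.1
  obtain ⟨hδ0, hδρ⟩ := lt_min_iff.1 hδ.2
  have h4δ : 4 * δ ≤ ε₀ := by linarith
  have hcε : 0 < min (η₀ / 4) (ρ / 4) := by positivity
  filter_upwards [hsδ, Ioo_mem_nhdsGT hcε] with ε hsε hε
  have hεpos : 0 < ε := hε.1
  obtain ⟨hε0, hερ⟩ := lt_min_iff.1 hε.2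
  have h4ε : 4 * ε ≤ η₀ := by linarith
  -- outside: no mass
  rcases hsε with hin4 | hout
  swap
  · rw [nsector_zero N z₁ d Q S hYm hm hRim hdet fun t ht v hv u hu =>
      hout t (Ioo_four hδt.1 ht) v (Ioo_four hδ.1 hv) u (Ioo_four hε.1 hu)]
    exact ENNReal.zero_lt_top
  have hin : ∀ t ∈ Ioo (0 : ℝ) δt, ∀ v ∈ Ioo (0 : ℝ) δ, ∀ u ∈ Ioo (0 : ℝ) ε,
      npt z₁ d Q S t v u ∈ Y := fun t ht v hv u hu =>
    hin4 t (Ioo_four hδt.1 ht) v (Ioo_four hδ.1 hv) u (Ioo_four hε.1 hu)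
  refine nsector_finite N z₁ d Q S hYm hm hRim hdet hin ?_
  -- the weight
  set ωa : ℝ → ℝ → ℝ → ℝ := fun t v u => |ω t v u| with hωa
  set Λ' : ℝ → ℝ → ℝ → ℝ≥0∞ := fun t v u => mm (npt z₁ d Q S t v u) with hΛ'
  set W : ℝ → ℝ → ℝ → ℝ≥0∞ := wt3 Dt Dv Du ωa Λ' with hW
  have hωam : Measurable fun p : ℝ × ℝ × ℝ => ωa p.1 p.2.1 p.2.2 := hωm.abs
  have hWm : Measurable fun p : ℝ × ℝ × ℝ => W p.1 p.2.1 p.2.2 :=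
    measurable_wt3 Dt Dv Du hωam (measurable_lmass_npt lo hi a z₁ d Q S)
  have hωB4 : ∀ t ∈ Ioo (0 : ℝ) (4 * δt), ∀ v ∈ Ioo (0 : ℝ) (4 * δ), ∀ u ∈ Ioo (0 : ℝ) (4 * ε),
      ωlo ≤ ωa t v u ∧ ωa t v u ≤ ωhi := fun t ht v hv u hu =>
    hωb t v u (by rw [abs_of_pos ht.1]; linarith [ht.2])
      (by rw [abs_of_pos hv.1]; linarith [hv.2]) (by rw [abs_of_pos hu.1]; linarith [hu.2])
  have hmonoW := wt3_mono Dt Dv Du hωlo hωB4 KΛ (Λ' := Λ') (hΛmono δt δ ε h4δt h4δ h4ε)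
  set K : ℝ≥0∞ := ENNReal.ofReal (4 ^ Dt * 4 ^ Dv * 4 ^ Du * (ωhi / ωlo)) * KΛ with hK
  have hKne : K ≠ ∞ := ENNReal.mul_ne_top ENNReal.ofReal_ne_top hKΛ
  -- the conversion identity on the big box
  have hden : ∀ t ∈ Ioo (0 : ℝ) (4 * δt), ∀ v ∈ Ioo (0 : ℝ) (4 * δ), ∀ u ∈ Ioo (0 : ℝ) (4 * ε),
      |common κ μ e n l₁ l₂ l₀ (npt z₁ d Q S t v u)| = t ^ Dt * v ^ Dv * u ^ Du * ωa t v u ∧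
        0 < t ^ Dt * v ^ Dv * u ^ Du * ωa t v u := by
    intro t ht v hv u hu
    refine ⟨hcommon t v u ht.1.le hv.1.le hu.1.le,
      mul_pos (mul_pos (mul_pos (pow_pos ht.1 _) (pow_pos hv.1 _)) (pow_pos hu.1 _)) ?_⟩
    exact hωlo.trans_le (hωB4 t ht v hv u hu).1
  have hWeq : ∀ t v u, W t v u =
      ENNReal.ofReal (t ^ 2 * v / (t ^ Dt * v ^ Dv * u ^ Du * ωa t v u)) * Λ' t v u :=
    fun t v u => rfl
  have hnumF := fun t v u => num_npt_frameIII N q l₁ l₂ l₀ z₁ d hlam hd cw hND β hβ hβ0 Qy Qc Sy Sc t v u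
  have hconvR : ∀ t ∈ Ioo (0 : ℝ) (4 * δt), ∀ v ∈ Ioo (0 : ℝ) (4 * δ), ∀ u ∈ Ioo (0 : ℝ) (4 * ε),
      ENNReal.ofReal (t ^ 2 * v) * (ENNReal.ofReal |R (npt z₁ d Q S t v u)| * mm (npt z₁ d Q S t v u)) =
        ENNReal.ofReal |pev₃ (∑ i, g i) t v u| * W t v u := by
    intro t ht v hv u hu
    have hnum : (∑ i ∈ Finset.range N, MvPolynomial.eval (pr2 (npt z₁ d Q S t v u)) (q i) *
        lam3 l₁ l₂ l₀ (npt z₁ d Q S t v u) ^ i) = pev₃ (∑ i, g i) t v u := by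
      rw [(hnumF t v u).2, pev₃_sum]
      exact Finset.sum_congr rfl fun i _ => (hg i t v u).symm
    rw [hR, hWeq]
    exact piece_eq_wt (by have := ht.1.le; have := hv.1.le; positivity) (by rw [hnum])
      (hden t ht v hv u hu).1 (hden t ht v hv u hu).2 _
  have hfin := hfin_of_inside3 z₁ d Q S hm hRm hfinY hdet hin4
  rw [setLIntegral_congr_fun measurableSet_Ioo fun t ht => setLIntegral_congr_fun measurableSet_Ioo
    fun v hv => setLIntegral_congr_fun measurableSet_Ioo fun u hu => hconvR t ht v hv u hu] at hfin
  -- the pieces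
  intro i hiR
  have hiN : i < N := Finset.mem_range.1 hiR
  set i' : Fin (D + 1) := ⟨i, lt_of_lt_of_le hiN hND⟩ with hi'
  have hconv : ∀ t ∈ Ioo (0 : ℝ) δt, ∀ v ∈ Ioo (0 : ℝ) δ, ∀ u ∈ Ioo (0 : ℝ) ε,
      ENNReal.ofReal (t ^ 2 * v) * (ENNReal.ofReal |Ri i (npt z₁ d Q S t v u)| * mm (npt z₁ d Q S t v u)) =
        ENNReal.ofReal |pev₃ (g i') t v u| * W t v u := by
    intro t ht v hv u hu
    have ht4 := Ioo_four hδt.1 ht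
    have hv4 := Ioo_four hδ.1 hv
    have hu4 := Ioo_four hε.1 hu
    have hnum : MvPolynomial.eval (pr2 (npt z₁ d Q S t v u)) (q i) * lam3 l₁ l₂ l₀ (npt z₁ d Q S t v u) ^ i =
        pev₃ (g i') t v u := by
      rw [(hnumF t v u).1 i hiN, hg]
    rw [hRi i hiN, hWeq]
    exact piece_eq_wt (by have := ht.1.le; have := hv.1.le; positivity) (by rw [hnum])
      (hden t ht4 v hv4 u hu4).1 (hden t ht4 v hv4 u hu4).2 _
  rw [setLIntegral_congr_fun measurableSet_Ioo fun t ht => setLIntegral_congr_fun measurableSet_Ioo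
    fun v hv => setLIntegral_congr_fun measurableSet_Ioo fun u hu => hconv t ht v hv u hu]
  exact ray_trigraded3 W hWm g K hKne δt δ ε hmonoW hdisj hfin i'

/-- **The vertical frame** `Q = Qy E`, `S = Sc c`. -/
theorem sector_IIIvert {k mL m'' : ℕ} (φ : Fin m'' → (Fin 3 → ℝ) × ℝ)
    (lo hi : Fin k → Fin k ⊕ Atm 3) (a : Fin k → Option (Atm 3))
    (κ : Fin mL → Fin 2 → ℝ) (μ : Fin mL → ℝ) (e : Fin mL → ℕ) (n : ℕ) (l₁ l₂ l₀ : ℝ)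
    (N : ℕ) (q : ℕ → MvPolynomial (Fin 2) ℝ) (R : (Fin 3 → ℝ) → ℝ) (Ri : ℕ → (Fin 3 → ℝ) → ℝ)
    (z₁ : Fin 3 → ℝ)
    (hR : ∀ x, R x = (∑ i ∈ Finset.range N, MvPolynomial.eval (pr2 x) (q i) * lam3 l₁ l₂ l₀ x ^ i) /
      common κ μ e n l₁ l₂ l₀ x)
    (hRi : ∀ i < N, ∀ x, Ri i x = MvPolynomial.eval (pr2 x) (q i) * lam3 l₁ l₂ l₀ x ^ i /
      common κ μ e n l₁ l₂ l₀ x)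
    (hRm : Measurable R) (hRim : ∀ i, Measurable (Ri i))
    (hfinY : ∫⁻ x in {x | ∀ j, 0 < rav x (φ j)}, ENNReal.ofReal |R x| * lmass lo hi a (av x) < ∞)
    (hlam : lam3 l₁ l₂ l₀ z₁ = 0) (d : Fin 3 → ℝ) (hd : lamL l₁ l₂ d = 0) (cw : Fin 2 → ℝ)
    (hdc : d 0 * cw 1 - d 1 * cw 0 ≠ 0)
    {D : ℕ} (hND : N ≤ D + 1) (β : Coef₃ D)
    (hβ : ∀ (i : ℕ) (hi : i < N) (w₁ w₂ : ℝ), MvPolynomial.eval (pr2 z₁ + w₁ • pr2 d + w₂ • cw) (q i) =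
      pev₂ (β ⟨i, lt_of_lt_of_le hi hND⟩) w₁ w₂)
    (hβ0 : ∀ i : Fin (D + 1), N ≤ (i : ℕ) → β i = 0)
    (Qy Sc : ℝ) (hQy : Qy ≠ 0) (hSc : Sc ≠ 0)
    (hκ : ∀ j ∈ thr κ μ e z₁, klin κ j d ≠ 0 ∨ κ j 0 * cw 0 + κ j 1 * cw 1 ≠ 0) :
    ∀ᶠ δt in 𝓝[>] (0 : ℝ), ∀ᶠ δ in 𝓝[>] (0 : ℝ), ∀ᶠ ε in 𝓝[>] (0 : ℝ),
      ∫⁻ z in nsector z₁ d (frameIII l₁ l₂ cw Qy 0) (frameIII l₁ l₂ cw 0 Sc) δt δ (Ico 0 ε),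
        {x : Fin 3 → ℝ | ∀ j, 0 < rav x (φ j)}.indicator
        (fun x => (∑ i ∈ Finset.range N, ENNReal.ofReal |Ri i x|) * lmass lo hi a (av x)) z < ∞ :=
  sector_IIImono φ lo hi a κ μ e n l₁ l₂ l₀ N q R Ri z₁ hR hRi hRm hRim hfinY hlam d hd cw hdc hND β hβ
    hβ0 Qy 0 0 Sc (by simpa using mul_ne_zero hQy hSc) hκ (gmon true β Qy 0 0 Sc)
    (fun i t v u => pev₃_gmon_vert β Qy Sc i t v u)
    (fun a' b' c' i i' h h' => gmon_disjoint true β Qy 0 0 Sc a' b' c' i i' h h')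

/-- **The slope-`0` frame** `Q = Qc c`, `S = Sy E`. -/
theorem sector_IIIzero {k mL m'' : ℕ} (φ : Fin m'' → (Fin 3 → ℝ) × ℝ)
    (lo hi : Fin k → Fin k ⊕ Atm 3) (a : Fin k → Option (Atm 3))
    (κ : Fin mL → Fin 2 → ℝ) (μ : Fin mL → ℝ) (e : Fin mL → ℕ) (n : ℕ) (l₁ l₂ l₀ : ℝ)
    (N : ℕ) (q : ℕ → MvPolynomial (Fin 2) ℝ) (R : (Fin 3 → ℝ) → ℝ) (Ri : ℕ → (Fin 3 → ℝ) → ℝ)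
    (z₁ : Fin 3 → ℝ)
    (hR : ∀ x, R x = (∑ i ∈ Finset.range N, MvPolynomial.eval (pr2 x) (q i) * lam3 l₁ l₂ l₀ x ^ i) /
      common κ μ e n l₁ l₂ l₀ x)
    (hRi : ∀ i < N, ∀ x, Ri i x = MvPolynomial.eval (pr2 x) (q i) * lam3 l₁ l₂ l₀ x ^ i /
      common κ μ e n l₁ l₂ l₀ x)
    (hRm : Measurable R) (hRim : ∀ i, Measurable (Ri i))
    (hfinY : ∫⁻ x in {x | ∀ j, 0 < rav x (φ j)}, ENNReal.ofReal |R x| * lmass lo hi a (av x) < ∞)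
    (hlam : lam3 l₁ l₂ l₀ z₁ = 0) (d : Fin 3 → ℝ) (hd : lamL l₁ l₂ d = 0) (cw : Fin 2 → ℝ)
    (hdc : d 0 * cw 1 - d 1 * cw 0 ≠ 0)
    {D : ℕ} (hND : N ≤ D + 1) (β : Coef₃ D)
    (hβ : ∀ (i : ℕ) (hi : i < N) (w₁ w₂ : ℝ), MvPolynomial.eval (pr2 z₁ + w₁ • pr2 d + w₂ • cw) (q i) =
      pev₂ (β ⟨i, lt_of_lt_of_le hi hND⟩) w₁ w₂)
    (hβ0 : ∀ i : Fin (D + 1), N ≤ (i : ℕ) → β i = 0)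
    (Qc Sy : ℝ) (hQc : Qc ≠ 0) (hSy : Sy ≠ 0)
    (hκ : ∀ j ∈ thr κ μ e z₁, klin κ j d ≠ 0 ∨ κ j 0 * cw 0 + κ j 1 * cw 1 ≠ 0) :
    ∀ᶠ δt in 𝓝[>] (0 : ℝ), ∀ᶠ δ in 𝓝[>] (0 : ℝ), ∀ᶠ ε in 𝓝[>] (0 : ℝ),
      ∫⁻ z in nsector z₁ d (frameIII l₁ l₂ cw 0 Qc) (frameIII l₁ l₂ cw Sy 0) δt δ (Ico 0 ε),
        {x : Fin 3 → ℝ | ∀ j, 0 < rav x (φ j)}.indicator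
        (fun x => (∑ i ∈ Finset.range N, ENNReal.ofReal |Ri i x|) * lmass lo hi a (av x)) z < ∞ :=
  sector_IIImono φ lo hi a κ μ e n l₁ l₂ l₀ N q R Ri z₁ hR hRi hRm hRim hfinY hlam d hd cw hdc hND β hβ
    hβ0 0 Qc Sy 0 (by simpa using mul_ne_zero hQc hSy) hκ (gmon false β 0 Sy Qc 0)
    (fun i t v u => pev₃_gmon_zero β Sy Qc i t v u)
    (fun a' b' c' i i' h h' => gmon_disjoint false β 0 Sy Qc 0 a' b' c' i i' h h')

end SepHHK

/-- **The sector theorem of type (III) for monomial frames** (registered part of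
`stub_separateHigh`, base dimension `3` with fibres; literal form of `SepHHK.sector_IIImono`): at
a base point of the pole plane, along the nested sector at a pole-plane direction whose Taylor
pieces are polynomials `pev₃ (g i)` with pairwise disjoint supports, the density of the pieces
against the fibre mass has finite integral for all small scales. -/
theorem separateThreeHHK_secIIIb (k mL m'' : ℕ) (φ : Fin m'' → (Fin 3 → ℝ) × ℝ) (lo hi : Fin k → Fin k ⊕ ((Fin 3 → ℚ) × ℚ)) (a : Fin k → Option ((Fin 3 → ℚ) × ℚ)) (κ : Fin mL → Fin 2 → ℝ) (μ : Fin mL → ℝ) (e : Fin mL → ℕ) (n : ℕ) (l₁ l₂ l₀ : ℝ) (N : ℕ) (q : ℕ → MvPolynomial (Fin 2) ℝ) (R : (Fin 3 → ℝ) → ℝ) (Ri : ℕ → (Fin 3 → ℝ) → ℝ) (z₁ : Fin 3 → ℝ) (hR : ∀ x, R x = (∑ i ∈ Finset.range N, MvPolynomial.eval (SepHHK.pr2 x) (q i) * SepHHK.lam3 l₁ l₂ l₀ x ^ i) / SepHHK.common κ μ e n l₁ l₂ l₀ x) (hRi : ∀ i < N, ∀ x, Ri i x = MvPolynomial.eval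 (SepHHK.pr2 x) (q i) * SepHHK.lam3 l₁ l₂ l₀ x ^ i / SepHHK.common κ μ e n l₁ l₂ l₀ x) (hRm : Measurable R) (hRim : ∀ i, Measurable (Ri i)) (hfinY : MeasureTheory.lintegral (MeasureTheory.volume.restrict {x | ∀ j, 0 < SepHHK.rav x (φ j)}) (fun x => ENNReal.ofReal |R x| * SepTwo.lmass lo hi a (SepTwo.av x)) < ⊤) (hlam : SepHHK.lam3 l₁ l₂ l₀ z₁ = 0) (d : Fin 3 → ℝ) (hd : SepHHK.lamL l₁ l₂ d = 0) (cw : Fin 2 → ℝ) (hdc : d 0 * cw 1 - d 1 * cw 0 ≠ 0) (D : ℕ) (hND : N ≤ D + 1) (β : Fin (D + 1) → Fin (D + 1) → Fin (D + 1) → ℝ) (hβ : ∀ (i : ℕ) (hi : i < N) (w₁ w₂ : ℝ), MvPolynomial.eval (SepHHK.pr2 z₁ + w₁ • SepHHK.pr2 d + w₂ • cw) (q i) = SepTwo.pev₂ (β ⟨i, lt_of_lt_of_le hi hND⟩) w₁ w₂) (hβ0 : ∀ i : Fin (D + 1), N ≤ (i : ℕ) → β i = 0) (Qy Qc Sy Sc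 : ℝ) (hfr : Qy * Sc - Qc * Sy ≠ 0) (hκ : ∀ j ∈ SepHHK.thr κ μ e z₁, SepHHK.klin κ j d ≠ 0 ∨ κ j 0 * cw 0 + κ j 1 * cw 1 ≠ 0) (g : Fin (D + 1) → Fin (3 * D + 1) → Fin (3 * D + 1) → Fin (3 * D + 1) → ℝ) (hg : ∀ (i : Fin (D + 1)) (t v u : ℝ), SepHHK.pev₃ (g i) t v u = SepHHK.G3p β Qy Sy Qc Sc i t v u) (hdisj : ∀ a' b' c' i i', g i a' b' c' ≠ 0 → g i' a' b' c' ≠ 0 → i = i') : ∀ᶠ δt in nhdsWithin (0 : ℝ) (Set.Ioi 0), ∀ᶠ δ in nhdsWithin (0 : ℝ) (Set.Ioi 0), ∀ᶠ ε in nhdsWithin (0 : ℝ) (Set.Ioi 0), MeasureTheory.lintegral (MeasureTheory.volume.restrict (SepHHK.nsector z₁ d (SepHHK.frameIII l₁ l₂ cw Qy Qc) (SepHHK.frameIII l₁ l₂ cw Sy Sc) δt δ (Set.Ico 0 ε))) (fun z => {x : Fin 3 → ℝ | ∀ j, 0 < SepHHK.rav x (φ j)}.indicator (fun x => (∑ i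 ∈ Finset.range N, ENNReal.ofReal |Ri i x|) * SepTwo.lmass lo hi a (SepTwo.av x)) z) < ⊤ := by
  exact SepHHK.sector_IIImono φ lo hi a κ μ e n l₁ l₂ l₀ N q R Ri z₁ hR hRi hRm hRim hfinY hlam d hd cw hdc hND β hβ hβ0 Qy Qc Sy Sc hfr hκ g hg hdisj

end Summit.KontsevichZagierPeriods.ArrangementNormalForm.JanusBands
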